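import Literature.MathematicalPhysics.QuantumFieldTheory.Balaban1983to89.B9B8DeltaPrimeJunction
import Literature.MathematicalPhysics.QuantumFieldTheory.Balaban1983to89.B9Thm311DeltaPrimePos

/-!
# `Balaban1983to89.B9Thm311PositivityKnitLetter` — [B9] THEOREM 3.11's POSITIVITY OF `Δ′_a(U)` ON THE TORUS AT THE [B8]-KNIT's LETTER:
# flat sections are transported by the AVERAGED holonomies `Ū^j(Γ^{(j)}_{y,x})` at EVERY configuration, hence `Δ′_a(U)` at `parKnitY` is positive
# definite and invertible, and the consumer's (E1) right-inverse identity holds EXACTLY at box points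

statement-level skeleton of published theorems with citation tags; proofs where landed; nothing here is a claim about the
Yang–Mills mass gap

T. Bałaban, *Propagators for lattice gauge theories in a background field*, Commun. Math. Phys. **99** (1985) 389–434
[`Balaban1985BackgroundPropagators`, "[B9]"]; T. Bałaban, *Averaging operations for lattice gauge theories*, Commun. Math. Phys. **98** (1985) 17–51
[`Balaban1985Averaging`, "[B7]"]; T. Bałaban, *Spaces of regular gauge field configurations on a lattice and gauge fixing conditions*, Commun. Math. Phys.
**99** (1985) 75–102 [`Balaban1985RegularSpaces`, "[B8]"].  PDFs held (`paper:balaban1985-cmp99-background-propagators`, journal page = PDF page + 388).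

THE PRINT (verbatim).  [B9] p. 395: *«Assuming some regularity of the configuration U it can be easily shown that the operator Δ′_a is positive.  This
implies positivity of the operators G′, Q′G′²Q′\*, hence the existence of the operator R.»*; (3.25) *«G′(U) = (Δ′_a(U))⁻¹»*; Thm 3.11 p. 416 (positivity
of the three operators).  [B7] (42) p. 23: *«V̄_c = exp[i Σ_{x∈B(c₋)} L^{−d} (1/i) log V(Γ_{c,x})V(c)⁻¹] V(c)»*, (21)–(22) p. 21 (the series `log`), (9) p. 18
(parallel transport along contours).

CITATION HEADER (lean-in-tree rule).  Cell `lit-balaban`, sub-row G-B9-LETTERS, row **M5.3 `B9Thm311PositivityTorusRegular`** of the lead's ALLOCATIONS #2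
(2026-08-28T01:07Z) AT THE CONSUMER's LETTER (junction J-B of RULING #3, file 3 of `lit-balaban-p33/JAB-STATEMENTS.md` v1.1) → seat `lit-balaban-p33` gen 91.
REUSED BY NAME: n06-j's sum-of-squares form `B9Thm311DeltaPrimePos.trIP_deltaPrimeAY_eq` and its positivity argument (re-run here with the weaker
corner-transport premise, §4), `isUnit_of_posDefTr ∕ posDefTr_ringInverse ∕ apply_inverse_of_isUnit`; [B7]'s word∕holonomy calculus (`B7Prop1Explicit.hol`,
`Wcx_eq_hol_loop`, `Xavg`, `bavg`, `expUnit`), `B7BlockAvgLog.commute_mlog_right`, Mathlib's `Commute.exp_left`; J-A∕J-B files 1–2 (`liftFun ∕ liftCfg`,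
`parKnitY`, `parOfT_blkCornerY`, `parKnitY_inv`, `deltaPrime_junction_at_box`).

WHAT THIS FILE PROVES (sorry-free; one definition with body — the consumer's Green's operator `GpKnitY`; everything else theorems).
* §1 FLAT SECTIONS ARE TRANSPORTED BY AVERAGED HOLONOMIES, AT EVERY CONFIGURATION (no smallness): if `R(V(x, x+e_μ))φ(x+e_μ) = φ(x)` on `ℤ^D` then
  `R(V(Γ))φ(x + |Γ|) = φ(x)` along every word (`hol_flat`); `φ(x)` COMMUTES with every closed-loop holonomy at `x`, hence with `log` of the loops of
  (42) (`commute_Xavg`, the series (21) termwise, summable or not) and with `exp` of their mean; so `R(V̄_c)φ(c₊) = φ(c₋)` for the average (42)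
  (`bavg_flat`), for all iterates `Ū^j` (43) (`avgIter_flat`), for the knit's block legs `Ū^j(Γ_{Ly,x})` (`bgT_flat`) and composite transporters
  `U(Γ^{(j)}_{y,x})` of (3.19) (`compT_flat`).
* §2–§3 ON THE TORUS: `∇_UΦ = 0` (def-Y's `cdS`) makes the periodic lift flat (`liftFun_flat`, by J-A's exact dictionary at `η = 1`), so the knit letter
  transports `Φ` from every site to the corner of its block: `R(parKnitY U c_s z)Φ(z) = Φ(c_s)` (`parKnitY_corner_transport`).
* §4 ★★ POSITIVITY: n06-j's theorem re-run with the CORNER-TRANSPORT premise (its `htr` asks transport between ALL pairs; the proof reads only corner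
  pairs) — `deltaPrimeAY_posDefTr_of_corner_transport`; hence ★★★ `deltaPrimeAY_parKnitY_posDefTr`: for `G ≤ U(N)`, a `G`-valued `U` whose knit legs are
  `G`-valued, `Δ′_a(U)` AT `parKnitY` IS POSITIVE DEFINITE; `IsUnit`, `G′ = Δ′_a⁻¹` positive definite and a two-sided inverse.
* §5 ★★★ THE CONSUMER's (E1) EXACTLY AT BOX POINTS: with `GpKnitY η U := η² • G′(U)` (def-Y's `GpY` at `parKnitY`), on constant-level members,
  `covLap η U₀ g (z) + QT L n (torusLam n) U₀ (awOp (cKnit η) (j ↦ Q′_j(U₀) g)) (z) = X(z)`, `g = liftFun ((GpKnitY η U X) ∘ chart)`, `U₀ = liftCfg U` —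
  the bounded right-inverse law (E1) of `B8Thm2TorusLetters.LettersAt(P)` for periodic arguments, read at the points of the fundamental box.

HONEST SCOPE.  (i) The `G`-valuedness of the knit legs (`hpar : ∀ z w, parKnitY i U z w ∈ G`) is a HYPOTHESIS here; it holds on the class (3.35) with
[B7]'s smallness by `B7Prop2Explicit.avgIter_mem` + `avgClosed_unitaryUnits` (file 4, with the plaquette-field dictionary).  (ii) (E1) is proved AT BOX
POINTS; the extension to all of `ℤ^{d+1}` by `N₀`-periodicity of both sides is file 4.  (iii) QUALITATIVE positivity only (print's «Δ′_a is positive»):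
no lower bound ∕ no estimate of [B9] Thm 3.1 is proved or asserted at `parKnitY` (w1's `(1∕8 − κα₀)L^{−2k}` is at `parSymY`; the transfer is an estimate,
flagged to the lead 2026-08-28T02:05Z).  (iv) `𝔸 = M_N(ℂ)` in §4–§5 (trace pairing), any complete normed `ℂ`-algebra in §1–§3.  Count-neutral (no new named
fact); nothing continuum, nothing about OS axioms or the mass gap.  No `sorry`, no `axiom`, no `instance`, no `notation`.  Seat `lit-balaban-p33` gen 91, 2026-08-28.
-/

noncomputable section

namespace Literature.MathematicalPhysics.QuantumFieldTheory.Balaban1983to89.B9Thm311PositivityKnitLetter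

open B7Prop1Explicit renaming Site → LSite
open B7Prop1Explicit (e hol stepHol disp Letter treeWord seg Wcx Xavg bavg expUnit hol_cons hol_nil disp_cons disp_nil disp_seg disp_treeWord
  disp_append disp_gammaWord stepHol_true stepHol_false val_expUnit Wcx_eq_hol_loop)
open Literature.MathematicalPhysics.QuantumLattice (blockMap blockBase)
open B7Eq78Linearization (conjR conjR_apply QprimeIter zdBlocking)
open B7Prop3GeneralRotated (conjR_mul_left)
open B8Eq191FlatStencils (conjR_unitOne)
open B7Prop2Explicit (avgIter avgIter_zero avgIter_succ rescale_apply)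
open B7BlockAvgLog (commute_mlog_right)
open B8Eq119TwistedAxial (bgT)
open B8Ineq132 (covDerivFwd)
open B8Eq138LandauZd (covLap QT)
open B8Thm4TorusAt (torusLam)
open B9Eq39Adjoint (R R_inv_R R_zero)
open B6Geom246MultiLevelBox (bset blkOf blkOf_eq_iff_blk blkOf_corner)
open B6MultiLevelBoxOperator (levC aPrinted)
open B6GlobalChartV1 (PV boxEquiv)
open B6KLevelCensusIndexV1 (KIdx)
open B9B8CarrierDictionary (liftFun liftCfg)
open B9B8AveragingKernelZd (compT compT_zero compT_succ)
open B9B8AveragingJunction (blk_eq_blockMap blockMap_iterate parKnitY parOfT_blkCornerY parKnitY_inv liftFun_chart_apply)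
open B9B8DeltaPrimeJunction (awOp cKnit deltaPrime_junction_at_box)
open B9Thm311ReadingCoords (trIP PosDefTr isUnit_of_posDefTr apply_inverse_of_isUnit inverse_apply_of_isUnit)
open B9Thm311DeltaPrimePos (trIP_self_nonneg trIP_self_pos blkSumY levC_blk_pos re_trace_conjTranspose_mul_self_nonneg
  eq_zero_of_re_trace_conjTranspose_mul_self_eq_zero trIP_deltaPrimeAY_eq posDefTr_ringInverse)
open Node00 NormedSpace

variable {d ℓ : ℕ} {hd : 1 ≤ d + 1} {hL : Odd (ℓ + 1) ∧ 1 < ℓ + 1} {b₀ b₁ : ℝ}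

/-! ## §1 Flat sections on `ℤ^D` are transported by words, loops, the average (42), its iterates (43) and the composite transporters (3.19) -/

section Flat

variable {D : ℕ} {𝔸 : Type*} [NormedRing 𝔸] [NormedAlgebra ℂ 𝔸] [CompleteSpace 𝔸]
variable {V : LSite D → Fin D → 𝔸ˣ} {φ : LSite D → 𝔸}

omit [NormedAlgebra ℂ 𝔸] [CompleteSpace 𝔸] in
/-- transport back along a bond: `R(u)a = b ⇒ R(u⁻¹)b = a`. [cite: Balaban1985Averaging, (9) p.18 («U(−b) = U(b)⁻¹»), bookkeeping] -/
theorem conjR_inv_of_conjR_eq {u : 𝔸ˣ} {a b : 𝔸} (h : conjR u a = b) : conjR u⁻¹ b = a := by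
  rw [← h, ← conjR_mul_left, inv_mul_cancel, conjR_unitOne]

omit [NormedAlgebra ℂ 𝔸] [CompleteSpace 𝔸] in
/-- `R(u)a = a` makes `u` and `a` COMMUTE. [cite: Balaban1985Averaging, (22) p.21 («unitarily equivalent»), bookkeeping] -/
theorem commute_of_conjR_eq {u : 𝔸ˣ} {a : 𝔸} (h : conjR u a = a) : Commute (u : 𝔸) a := by
  rw [conjR_apply] at h
  show (u : 𝔸) * a = a * u
  calc (u : 𝔸) * a = (u : 𝔸) * a * (((u⁻¹ : 𝔸ˣ) : 𝔸) * (u : 𝔸)) := by rw [Units.inv_mul, mul_one]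
    _ = (u : 𝔸) * a * ((u⁻¹ : 𝔸ˣ) : 𝔸) * (u : 𝔸) := by rw [← mul_assoc]
    _ = a * (u : 𝔸) := by rw [h]

omit [NormedAlgebra ℂ 𝔸] [CompleteSpace 𝔸] in
/-- commuting elements are fixed by the conjugation: `ua = au ⇒ R(u)a = a`. [cite: Balaban1985Averaging, (22) p.21, bookkeeping] -/
theorem conjR_eq_self_of_commute {u : 𝔸ˣ} {a : 𝔸} (h : Commute (u : 𝔸) a) : conjR u a = a := by
  rw [conjR_apply, h.eq, mul_assoc, Units.mul_inv, mul_one]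

omit [NormedAlgebra ℂ 𝔸] [CompleteSpace 𝔸] in
/-- a flat section is transported by every LETTER (forward bond `V(b)`, backward bond `V(b)⁻¹`). [cite: Balaban1985Averaging, (9) p.18] -/
theorem stepHol_flat (hflat : ∀ x μ, conjR (V x μ) (φ (x + e μ)) = φ x) (x : LSite D) (l : Letter D) :
    conjR (stepHol V x l) (φ (x + l.vec)) = φ x := by
  obtain ⟨μ, b⟩ := l
  cases b
  · rw [stepHol_false, Letter.vec_false, ← sub_eq_add_neg]
    apply conjR_inv_of_conjR_eq
    have h := hflat (x - e μ) μ
    rwa [sub_add_cancel] at h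
  · rw [stepHol_true, Letter.vec_true]
    exact hflat x μ

omit [NormedAlgebra ℂ 𝔸] [CompleteSpace 𝔸] in
/-- ★ **A FLAT SECTION IS TRANSPORTED ALONG EVERY CONTOUR**: `R(V(Γ))φ(x + |Γ|) = φ(x)` for the word `Γ` spelled from `x` ((9): `V(Γ) = V(b₁)⋯V(b_n)`).
[cite: Balaban1985Averaging, (9) p.18] -/
theorem hol_flat (hflat : ∀ x μ, conjR (V x μ) (φ (x + e μ)) = φ x) :
    ∀ (x : LSite D) (w : List (Letter D)), conjR (hol V x w) (φ (x + disp w)) = φ x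
  | x, [] => by rw [hol_nil, disp_nil, add_zero, conjR_unitOne]
  | x, l :: w => by
      rw [hol_cons, disp_cons, ← add_assoc, conjR_mul_left, hol_flat hflat (x + l.vec) w, stepHol_flat hflat x l]

omit [NormedAlgebra ℂ 𝔸] [CompleteSpace 𝔸] in
/-- ★ a flat section at `x` COMMUTES WITH EVERY CLOSED-LOOP HOLONOMY based at `x`. [cite: Balaban1985Averaging, (9) p.18, (42) p.23 («V(Γ_{c,x})V(c)⁻¹»)] -/
theorem commute_hol_loop (hflat : ∀ x μ, conjR (V x μ) (φ (x + e μ)) = φ x) (x : LSite D) (w : List (Letter D)) (hw : disp w = 0) :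
    Commute ((hol V x w : 𝔸ˣ) : 𝔸) (φ x) :=
  commute_of_conjR_eq (by have h := hol_flat hflat x w; rwa [hw, add_zero] at h)

omit [NormedAlgebra ℂ 𝔸] [CompleteSpace 𝔸] in
/-- the loop variables `V(Γ_{c,x})V(c)⁻¹` of (42) commute with a flat section at `c₋`. [cite: Balaban1985Averaging, (42) p.23] -/
theorem commute_Wcx (hflat : ∀ x μ, conjR (V x μ) (φ (x + e μ)) = φ x) (L : ℕ) (q : LSite D) (κ : Fin D) (r : LSite D) :
    Commute ((Wcx L V q κ r : 𝔸ˣ) : 𝔸) (φ q) := by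
  rw [Wcx_eq_hol_loop]
  exact commute_hol_loop hflat q _ (by rw [disp_append, disp_gammaWord, disp_seg, neg_smul, add_neg_cancel])

omit [CompleteSpace 𝔸] in
/-- ★ THE EXPONENT OF (42), `X_c = Σ_x L^{−d} log[V(Γ_{c,x})V(c)⁻¹]`, COMMUTES WITH A FLAT SECTION AT `c₋` — the series (21) termwise
(`B7BlockAvgLog.commute_mlog_right`, which needs no summability: outside the disc both sides of every identity read the series' default value).
[cite: Balaban1985Averaging, (42) p.23, (21)–(22) p.21] -/
theorem commute_Xavg (hflat : ∀ x μ, conjR (V x μ) (φ (x + e μ)) = φ x) (L : ℕ) (q : LSite D) (κ : Fin D) :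
    Commute (Xavg L V q κ) (φ q) := by
  unfold Xavg
  exact Commute.sum_left _ _ _ fun r _ => (commute_mlog_right (commute_Wcx hflat L q κ _).symm).symm.smul_left _

/-- ★ **THE AVERAGE (42) TRANSPORTS FLAT SECTIONS**: `R(V̄_c)φ(c₊) = φ(c₋)`, `c = ⟨q, q + Le_κ⟩` — `V̄_c = e^{X_c}V(c)`, the straight contour `V(c)` transports
`φ(c₊)` to `φ(c₋)` and `e^{X_c}` commutes with `φ(c₋)`. [cite: Balaban1985Averaging, (42) p.23] -/
theorem bavg_flat (hflat : ∀ x μ, conjR (V x μ) (φ (x + e μ)) = φ x) (L : ℕ) (q : LSite D) (κ : Fin D) :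
    conjR (bavg L V q κ) (φ (q + (L : ℤ) • e κ)) = φ q := by
  show conjR (expUnit (Xavg L V q κ) * hol V q (seg κ L)) (φ (q + (L : ℤ) • e κ)) = φ q
  have h := hol_flat hflat q (seg κ (L : ℤ))
  rw [disp_seg] at h
  rw [conjR_mul_left, h]
  apply conjR_eq_self_of_commute
  rw [val_expUnit]
  exact (commute_Xavg hflat L q κ).exp_left

/-- ★ **ALL ITERATED AVERAGES (43) TRANSPORT FLAT SECTIONS**: with `φ_j(x) := φ(Lʲx)` (the section read on the level-`j` lattice),
`R(Ū^j(x, x+e_μ))φ_j(x + e_μ) = φ_j(x)`. [cite: Balaban1985Averaging, (43) p.24] -/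
theorem avgIter_flat (hflat : ∀ x μ, conjR (V x μ) (φ (x + e μ)) = φ x) (L : ℕ) :
    ∀ (j : ℕ) (x : LSite D) (μ : Fin D), conjR (avgIter L V j x μ) (φ (((L : ℤ) ^ j) • (x + e μ))) = φ (((L : ℤ) ^ j) • x)
  | 0, x, μ => by rw [avgIter_zero, pow_zero, one_smul, one_smul]; exact hflat x μ
  | j + 1, x, μ => by
      rw [avgIter_succ, rescale_apply]
      have hflatj : ∀ (y : LSite D) (ν : Fin D),
          conjR (avgIter L V j y ν) (φ (((L : ℤ) ^ j) • (y + e ν))) = φ (((L : ℤ) ^ j) • y) := fun y ν => avgIter_flat hflat L j y ν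
      have h := bavg_flat (V := avgIter L V j) (φ := fun y => φ (((L : ℤ) ^ j) • y)) hflatj L ((L : ℤ) • x) μ
      have e1 : ((L : ℤ) ^ (j + 1)) • (x + e μ) = ((L : ℤ) ^ j) • ((L : ℤ) • x + (L : ℤ) • e μ) := by rw [pow_succ, mul_smul, smul_add]
      have e2 : ((L : ℤ) ^ (j + 1)) • x = ((L : ℤ) ^ j) • ((L : ℤ) • x) := by rw [pow_succ, mul_smul]
      rw [e1, e2]
      exact h

omit [NormedAlgebra ℂ 𝔸] [CompleteSpace 𝔸] in
/-- the block corner `L·y` as a scalar multiple. [cite: Balaban1985Averaging, (78) p.30, bookkeeping] -/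
theorem blockBase_eq_smul (M : ℕ) (y : LSite D) : blockBase M y = (M : ℤ) • y := by
  funext ν; simp [blockBase]

/-- ★ THE KNIT's LEVEL LEGS `Ū^j(Γ_{Ly,x})` (`B8Eq119TwistedAxial.bgT`) TRANSPORT FLAT SECTIONS: `R(Ū^j(Γ_{Ly,x′}))φ_j(x′) = φ_j(Ly)`.
[cite: Balaban1985Averaging, (78)–(80) p.30; Balaban1985RegularSpaces, (1.29) p.81] -/
theorem bgT_flat (hflat : ∀ x μ, conjR (V x μ) (φ (x + e μ)) = φ x) (L j : ℕ) (y x' : LSite D) :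
    conjR (bgT L V j y x') (φ (((L : ℤ) ^ j) • x')) = φ (((L : ℤ) ^ j) • blockBase L y) := by
  have h := hol_flat (V := avgIter L V j) (φ := fun z => φ (((L : ℤ) ^ j) • z)) (fun z ν => avgIter_flat hflat L j z ν)
    (blockBase L y) (treeWord (x' - blockBase L y))
  rw [disp_treeWord, add_sub_cancel] at h
  exact h

/-- ★★ **THE COMPOSITE TRANSPORTERS `U(Γ^{(j)}_{y,x})` OF (3.19) TRANSPORT FLAT SECTIONS TO THE BLOCK CORNER**: `R(T^{(j)}(y, x))φ(x) = φ(Lʲy)`,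
`y = blockMap^{[j]} x`, at EVERY configuration. [cite: Balaban1985BackgroundPropagators, (3.19) p.393; Balaban1985Averaging, (52)–(53) p.27] -/
theorem compT_flat (hflat : ∀ x μ, conjR (V x μ) (φ (x + e μ)) = φ x) (L : ℕ) :
    ∀ (j : ℕ) (x : LSite D), conjR (compT L (bgT L V) j ((blockMap L)^[j] x) x) (φ x) = φ (((L : ℤ) ^ j) • (blockMap L)^[j] x)
  | 0, x => by rw [compT_zero, conjR_unitOne, pow_zero, one_smul, Function.iterate_zero_apply]
  | j + 1, x => by
      rw [compT_succ, conjR_mul_left, compT_flat hflat L j x, bgT_flat hflat L j, Function.iterate_succ_apply', blockBase_eq_smul,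
        pow_succ, mul_smul]

end Flat

/-! ## §2 On the torus: `∇_UΦ = 0` makes the periodic lift flat -/

section Torus

variable {𝔸 : Type} [NormedRing 𝔸] [NormedAlgebra ℂ 𝔸] [CompleteSpace 𝔸]
variable (i : KIdx d ℓ hd hL b₀ b₁)

/-- a covariantly constant site function on def-Y's box chart lifts to a flat section of the periodic `ℤ^{d+1}` data (J-A's exact dictionary
`covDerivFwd_liftY` at `η = 1`). [cite: Balaban1985BackgroundPropagators, (3.3) p.390; Balaban1985RegularSpaces, (1.1) p.76, p.77 («Ω_j = T_η»)] -/
theorem liftFun_flat (U : CfgY 𝔸 i) (Φ : SiteY i → 𝔸) (hΦ : ∀ μ, cdS i U μ Φ = 0) (x : LSite (d + 1)) (μ : Fin (d + 1)) :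
    conjR (liftCfg U x μ) (liftFun (Φ ∘ ⇑(boxEquiv i.hN)) (x + e μ)) = liftFun (Φ ∘ ⇑(boxEquiv i.hN)) x := by
  have h := B9B8CarrierDictionary.covDerivFwd_liftY i 1 U μ Φ x
  have h0 : cdS i U μ Φ (boxEquiv i.hN (B10Eq27TorusAxialLog.transl 0 x)) = 0 := by rw [hΦ μ]; rfl
  rw [h0, smul_zero, covDerivFwd, inv_one, one_smul, sub_eq_zero] at h
  exact h

/-! ## §3 The knit letter transports a covariantly constant `Φ` from every site to the corner of its block -/

/-- ★★ **CORNER TRANSPORT AT `parKnitY`, EVERY CONFIGURATION**: if `∇_UΦ = 0` then `R(U(Γ^{(j)}_{y,z}))Φ(z) = Φ(c_s)` for every block `s = (j, y) ∈ 𝔅`, its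
corner `c_s = Lʲy` and every `z ∈ s`. [cite: Balaban1985BackgroundPropagators, (3.19) p.393, p.395 («Δ′_a is positive»)] -/
theorem parKnitY_corner_transport (U : CfgY 𝔸 i) (Φ : SiteY i → 𝔸) (hΦ : ∀ μ, cdS i U μ Φ = 0) {s : BlkY i} {z : SiteY i}
    (hz : blkOf i.D.toDomains z = s) : R (parKnitY i U (blkCornerY i s) z) (Φ z) = Φ (blkCornerY i s) := by
  have hanc : (blockMap (ℓ + 1))^[s.1.1] z.1 = s.1.2 := by
    rw [blockMap_iterate, ← blk_eq_blockMap]; exact (blkOf_eq_iff_blk i.D.toDomains).1 hz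
  have hcor : (blkCornerY i s).1 = ((((ℓ + 1 : ℕ) : ℤ)) ^ s.1.1) • s.1.2 := by
    funext μ
    show (((ℓ + 1) ^ s.1.1 : ℕ) : ℤ) * s.1.2 μ = _
    rw [Pi.smul_apply, smul_eq_mul, Nat.cast_pow]
  have hpar : parKnitY i U (blkCornerY i s) z = compT (ℓ + 1) (bgT (ℓ + 1) (liftCfg U)) s.1.1 s.1.2 z.1 := parOfT_blkCornerY i _ hz
  rw [hpar, ← liftFun_chart_apply i Φ z, ← liftFun_chart_apply i Φ (blkCornerY i s), hcor, ← hanc]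
  exact compT_flat (liftFun_flat i U Φ hΦ) (ℓ + 1) s.1.1 z.1

end Torus

/-! ## §4 Positivity of `Δ′_a(U)` at the knit letter ([B9] p. 395, Thm 3.11) -/

section Pos

open scoped Matrix Matrix.Norms.L2Operator

variable {N : ℕ} (i : KIdx d ℓ hd hL b₀ b₁) {G : Subgroup (Matrix (Fin N) (Fin N) ℂ)ˣ}

/-- ★★ **`Δ′_a(U)` IS POSITIVE DEFINITE on an inverse-symmetric `G`-valued transporter table that transports flat sections FROM EVERY SITE TO THE CORNER OF
ITS BLOCK** (`G ≤ U(N)`, `G`-valued `U`) — n06-j's `deltaPrimeAY_posDefTr_of_flat_transport` with the premise weakened to the corner pairs its proof reads: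
the form (3.24) is a sum of squares (`trIP_deltaPrimeAY_eq`); if it vanishes then `∇_UΦ = 0` and every transported block sum `= |s|·Φ(c_s)` vanishes, so
`Φ(c_s) = 0` at every corner and, transporting back, `Φ ≡ 0`. [cite: Balaban1985BackgroundPropagators, (3.24) pp.394–395, Thm 3.11 p.416] -/
theorem deltaPrimeAY_posDefTr_of_corner_transport (hG : G ≤ B7Prop2Explicit.unitaryUnits (Matrix (Fin N) (Fin N) ℂ))
    (par : SiteParY (Matrix (Fin N) (Fin N) ℂ) i) (U : CfgY (Matrix (Fin N) (Fin N) ℂ) i) (hinv : ∀ z z' : SiteY i, par U z z' = (par U z' z)⁻¹)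
    (hpar : ∀ z w : SiteY i, par U z w ∈ G) (hU : ∀ μ x, U μ x ∈ G)
    (htr : ∀ Φ : SiteY i → Matrix (Fin N) (Fin N) ℂ, (∀ μ, cdS i U μ Φ = 0) →
      ∀ (s : BlkY i) (z : SiteY i), blkOf i.D.toDomains z = s → R (par U (blkCornerY i s) z) (Φ z) = Φ (blkCornerY i s)) :
    PosDefTr (fun _ => (1 : ℝ)) (deltaPrimeAY i par U) := by
  intro Φ hΦ
  have hl : ∀ μ, 0 ≤ trIP (fun _ => (1 : ℝ)) (cdS i U μ Φ) (cdS i U μ Φ) := fun μ => trIP_self_nonneg _ (fun _ => one_pos) _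
  have ha : ∀ s : BlkY i, 0 ≤ levC d ℓ (aPrinted ℓ 1) s.1.1 * (Matrix.trace ((blkSumY i par U Φ s)ᴴ * blkSumY i par U Φ s)).re := fun s =>
    mul_nonneg (levC_blk_pos i s).le (re_trace_conjTranspose_mul_self_nonneg _)
  have hlap := Finset.sum_nonneg fun μ (_ : μ ∈ Finset.univ) => hl μ
  have havg := Finset.sum_nonneg fun s (_ : s ∈ Finset.univ) => ha s
  rw [trIP_deltaPrimeAY_eq i hG par U hinv hpar hU Φ]
  refine (add_nonneg hlap havg).lt_of_ne fun h0 => hΦ ?_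
  -- (i) `∇_UΦ = 0`; (ii) every transported block sum vanishes
  have hcd : ∀ μ, cdS i U μ Φ = 0 := fun μ => by
    by_contra hne
    have h := (Finset.sum_eq_zero_iff_of_nonneg fun μ _ => hl μ).1 (by linarith) μ (Finset.mem_univ μ)
    exact (trIP_self_pos (fun _ : SiteY i => (1 : ℝ)) (fun _ => one_pos) hne).ne' h
  have hB : ∀ s, blkSumY i par U Φ s = 0 := fun s => by
    have h := (Finset.sum_eq_zero_iff_of_nonneg fun s _ => ha s).1 (by linarith) s (Finset.mem_univ s)
    exact eq_zero_of_re_trace_conjTranspose_mul_self_eq_zero ((mul_eq_zero.1 h).resolve_left (levC_blk_pos i s).ne')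
  -- (iii) by corner transport each block sum is `|s| • Φ(c_s)`, so `Φ(c_s) = 0`
  have hcorner : ∀ s : BlkY i, Φ (blkCornerY i s) = 0 := by
    intro s
    have hsum : blkSumY i par U Φ s
        = (((Finset.univ.filter (fun z : SiteY i => blkOf i.D.toDomains z = s)).card : ℕ) : ℂ) • Φ (blkCornerY i s) := by
      rw [blkSumY, Nat.cast_smul_eq_nsmul, ← Finset.sum_const]
      exact Finset.sum_congr rfl fun z hz => htr Φ hcd s z (Finset.mem_filter.1 hz).2
    rw [hB s] at hsum
    refine (smul_eq_zero.1 hsum.symm).resolve_left (Nat.cast_ne_zero.2 (Finset.card_ne_zero.2 ⟨blkCornerY i s, ?_⟩))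
    rw [Finset.mem_filter]
    exact ⟨Finset.mem_univ _, blkOf_corner i.D.toDomains s⟩
  -- (iv) transport back from the corner of its own block: `Φ ≡ 0`
  funext z
  have h := htr Φ hcd (blkOf i.D.toDomains z) z rfl
  rw [hcorner] at h
  have h' := congrArg (R (par U (blkCornerY i (blkOf i.D.toDomains z)) z)⁻¹) h
  rwa [R_inv_R, R_zero] at h'

/-- ★★★ **[B9] THM 3.11's POSITIVITY AT THE [B8]-KNIT's LETTER**: for `G ≤ U(N)`, a `G`-valued configuration `U` on the torus whose knit transporters
`parKnitY U` are `G`-valued, def-Y's `Δ′_a(U)` at `parKnitY` — the consumer's pinned operator of (E1), by `B9B8DeltaPrimeJunction.deltaPrime_junction_at_box`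
— IS POSITIVE DEFINITE.  No smallness of the field beyond the `G`-valuedness of the legs (print: «assuming some regularity of the configuration U»).
[cite: Balaban1985BackgroundPropagators, p.395 («Δ′_a is positive»), (3.24) p.394, Thm 3.11 p.416] -/
theorem deltaPrimeAY_parKnitY_posDefTr (hG : G ≤ B7Prop2Explicit.unitaryUnits (Matrix (Fin N) (Fin N) ℂ)) {U : CfgY (Matrix (Fin N) (Fin N) ℂ) i}
    (hU : ∀ μ x, U μ x ∈ G) (hpar : ∀ z w : SiteY i, parKnitY i U z w ∈ G) : PosDefTr (fun _ => (1 : ℝ)) (deltaPrimeAY i (parKnitY i) U) :=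
  deltaPrimeAY_posDefTr_of_corner_transport i hG (parKnitY i) U (parKnitY_inv i U) hpar hU
    fun Φ hΦ _ _ hz => parKnitY_corner_transport i U Φ hΦ hz

/-- hence `Δ′_a(U)` at the knit letter is INVERTIBLE. [cite: Balaban1985BackgroundPropagators, (3.25) p.394 («G′(U) = (Δ′_a(U))⁻¹»)] -/
theorem isUnit_deltaPrimeAY_parKnitY (hG : G ≤ B7Prop2Explicit.unitaryUnits (Matrix (Fin N) (Fin N) ℂ)) {U : CfgY (Matrix (Fin N) (Fin N) ℂ) i}
    (hU : ∀ μ x, U μ x ∈ G) (hpar : ∀ z w : SiteY i, parKnitY i U z w ∈ G) : IsUnit (deltaPrimeAY i (parKnitY i) U) :=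
  isUnit_of_posDefTr (deltaPrimeAY_parKnitY_posDefTr i hG hU hpar)

/-- ★ **THM 3.11's SECOND OPERATOR AT THE KNIT LETTER: `G′(U) = Δ′_a(U)⁻¹` is positive definite.** [cite: Balaban1985BackgroundPropagators, p.395, Thm 3.11 p.416] -/
theorem GpY_parKnitY_posDefTr (hG : G ≤ B7Prop2Explicit.unitaryUnits (Matrix (Fin N) (Fin N) ℂ)) {U : CfgY (Matrix (Fin N) (Fin N) ℂ) i}
    (hU : ∀ μ x, U μ x ∈ G) (hpar : ∀ z w : SiteY i, parKnitY i U z w ∈ G) : PosDefTr (fun _ => (1 : ℝ)) (GpY i (parKnitY i) U) :=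
  posDefTr_ringInverse (deltaPrimeAY_parKnitY_posDefTr i hG hU hpar)

/-- `Δ′_a(U) G′(U) X = X` at the knit letter. [cite: Balaban1985BackgroundPropagators, (3.25) p.394] -/
theorem deltaPrimeAY_GpY_parKnitY_apply (hG : G ≤ B7Prop2Explicit.unitaryUnits (Matrix (Fin N) (Fin N) ℂ)) {U : CfgY (Matrix (Fin N) (Fin N) ℂ) i}
    (hU : ∀ μ x, U μ x ∈ G) (hpar : ∀ z w : SiteY i, parKnitY i U z w ∈ G) (X : SiteY i → Matrix (Fin N) (Fin N) ℂ) :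
    deltaPrimeAY i (parKnitY i) U (GpY i (parKnitY i) U X) = X :=
  apply_inverse_of_isUnit (isUnit_deltaPrimeAY_parKnitY i hG hU hpar) X

/-- `G′(U) Δ′_a(U) Φ = Φ` at the knit letter. [cite: Balaban1985BackgroundPropagators, (3.25) p.394] -/
theorem GpY_deltaPrimeAY_parKnitY_apply (hG : G ≤ B7Prop2Explicit.unitaryUnits (Matrix (Fin N) (Fin N) ℂ)) {U : CfgY (Matrix (Fin N) (Fin N) ℂ) i}
    (hU : ∀ μ x, U μ x ∈ G) (hpar : ∀ z w : SiteY i, parKnitY i U z w ∈ G) (Φ : SiteY i → Matrix (Fin N) (Fin N) ℂ) :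
    GpY i (parKnitY i) U (deltaPrimeAY i (parKnitY i) U Φ) = Φ :=
  inverse_apply_of_isUnit (isUnit_deltaPrimeAY_parKnitY i hG hU hpar) Φ

end Pos

/-! ## §5 The consumer's right-inverse law (E1), exactly, at box points -/

section E1

open scoped Matrix Matrix.Norms.L2Operator

variable {N : ℕ} (i : KIdx d ℓ hd hL b₀ b₁) {G : Subgroup (Matrix (Fin N) (Fin N) ℂ)ˣ}

/-- **THE CONSUMER's GREEN's OPERATOR at truncation level, on def-Y's carrier**: `η² · G′(U)` with `G′(U) = Δ′_a(U)⁻¹` at the knit letter (the `η²` carries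
def-Y's lattice units to the knit's `η`-units of `covLap η`, cf. `B9B8DeltaPrimeJunction.cKnit`). [cite: Balaban1985BackgroundPropagators, (3.25) p.394; Balaban1985RegularSpaces, (1.95) p.91] -/
def GpKnitY (η : ℝ) (U : CfgY (Matrix (Fin N) (Fin N) ℂ) i) :
    (SiteY i → Matrix (Fin N) (Fin N) ℂ) →ₗ[ℂ] (SiteY i → Matrix (Fin N) (Fin N) ℂ) :=
  (((η * η : ℝ)) : ℂ) • GpY i (parKnitY i) U

/-- the Green's operator, evaluated. [cite: Balaban1985BackgroundPropagators, (3.25) p.394, bookkeeping] -/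
theorem GpKnitY_apply (η : ℝ) (U : CfgY (Matrix (Fin N) (Fin N) ℂ) i) (X : SiteY i → Matrix (Fin N) (Fin N) ℂ) :
    GpKnitY i η U X = (((η * η : ℝ)) : ℂ) • GpY i (parKnitY i) U X := rfl

/-- ★★★ **(E1) OF `B8Thm2TorusLetters.LettersAt(P)`, EXACTLY, AT BOX POINTS.**  On a constant-level member (`∀ z, j(z) = n`, the trivial domain sequence),
for `G ≤ U(N)`, a `G`-valued `U` with `G`-valued knit legs, `η ≠ 0`, every `X` on the box chart and every box site `z`: with `g = liftFun ((GpKnitY η U X) ∘ chart)`,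
`U₀ = liftCfg U`,  `covLap η U₀ g (z) + QT L n (torusLam n) U₀ (awOp (cKnit η) (j ↦ QprimeIter (zdBlocking (d+1) L) (bgT L U₀) j g)) (z) = X(z)` — the consumer's
`Δ′ ∘ Gp = 1` read through (E3)∕(E4)∕(E5) on periodic data at the points of the fundamental box. [cite: Balaban1985BackgroundPropagators, (3.24)–(3.25) pp.394–395, Thm 3.11 p.416; Balaban1985RegularSpaces, (1.95) p.91, (1.29) p.81, p.77 («Ω_j = T_η»)] -/
theorem knit_E1_at_box {n : ℕ} (hlev : ∀ z : SiteY i, levY i z = n) (hG : G ≤ B7Prop2Explicit.unitaryUnits (Matrix (Fin N) (Fin N) ℂ))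
    {U : CfgY (Matrix (Fin N) (Fin N) ℂ) i} (hU : ∀ μ x, U μ x ∈ G) (hpar : ∀ z w : SiteY i, parKnitY i U z w ∈ G) {η : ℝ} (hη : η ≠ 0)
    (X : SiteY i → Matrix (Fin N) (Fin N) ℂ) (z : SiteY i) :
    covLap η (liftCfg U) (liftFun ((GpKnitY i η U X) ∘ ⇑(boxEquiv i.hN))) z.1
        + QT (ℓ + 1) n (torusLam n) (liftCfg U)
            (awOp (cKnit (d := d) (ℓ := ℓ) η) fun j =>
              QprimeIter (zdBlocking (d + 1) (ℓ + 1)) (bgT (ℓ + 1) (liftCfg U)) j (liftFun ((GpKnitY i η U X) ∘ ⇑(boxEquiv i.hN)))) z.1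
      = X z := by
  rw [deltaPrime_junction_at_box i hlev η U (GpKnitY i η U X) z, GpKnitY_apply, map_smul, deltaPrimeAY_GpY_parKnitY_apply i hG hU hpar X,
    Pi.smul_apply, ← Complex.coe_smul, smul_smul, ← Complex.ofReal_mul]
  have h1 : η⁻¹ * η⁻¹ * (η * η) = 1 := by field_simp
  rw [h1, Complex.ofReal_one, one_smul]

end E1

end Literature.MathematicalPhysics.QuantumFieldTheory.Balaban1983to89.B9Thm311PositivityKnitLetter

end
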